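import Mathlib.MeasureTheory.SpecificCodomains.WithLp
import Literature.Analysis.FluidPDE.FracLaplacianSmooth
import Literature.Analysis.FunctionSpaces.TorusInverseLaplacian
import Literature.Analysis.FunctionSpaces.TorusSpaceTimeFields
import HarnessLib

/-!
# The spectral fractional Laplacian as a mollification: smoothness and joint space–time smoothness

Analysis/FluidPDE proof-only complement to `FractionalNSTorus` / `FracLaplacianSmooth`
(`Torus.fracLaplacian α ψ x = Re ∑ₖ (4π²|k|²)^α ψ̂(k) e^{2πik·x}`, convergent with continuous sum
for smooth `ψ`, `α ≥ 0`). Here `(-Δ)^α` is realised, on smooth fields, as an honest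
**mollification of a derivative** — the construction of the tree's inverse Laplacian
(`TorusInverseLaplacian`: `Δ⁻¹h = c • K ⋆ Δ^{N-1}h`) run for the symbol `(4π²|k|²)^α`:

  `(-Δ)^α a = K_α ⋆ ((1 - (4π²)⁻¹Δ)^M a)`,  `M = ⌈α⌉ + #d`,
  `K_α = ∑ₖ (4π²|k|²)^α (1 + |k|²)^{-M} e_k` (a continuous real kernel: the multiplier is
  `≤ (4π²)^α (1 + |k|²)^{-#d}`, absolutely summable),

by the convolution theorem (`Torus.mFourierCoeff_convolution`, Grafakos 2014, Prop. 3.1.2 (9)),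
the multiplier of the elliptic iterate (`Torus.mFourierCoeff_complexify_iterate_oneSubLaplacian`:
`(1 + |k|²)^M`) and uniqueness of Fourier coefficients of continuous functions
(`Torus.eq_of_forall_mFourierCoeff_eq`). Consequences (all proved):

* `Torus.IsSmooth.fracLaplacian` — `(-Δ)^α a` is smooth for smooth `a` (`α ≥ 0`);
* `Torus.IsSmoothSpaceTimeOn.fracLaplacian_univ` — **joint space–time smoothness**: for `u` smooth
  on `ℝ × T^d`, `(t, x) ↦ ((-Δ)^α u(t))(x)` is smooth on `ℝ × T^d` (slice-wise mollification of the
  jointly smooth `(1 - (4π²)⁻¹Δ)^M u` preserves joint smoothness,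
  `Torus.IsSmoothSpaceTimeOn.convolution` of `TorusSpaceTimeKernel`). This is what makes
  `R₀ = ℛ(∂ₜu + ν(-Δ)^θ u) + …` a smooth Reynolds stress in the first step of Luo–Titi's scheme
  (Luo–Titi 2020, §2.1, proof of Theorem 1) for a general smooth datum `u`.

All statements are folklore Fourier analysis on the torus (Grafakos 2014, Prop. 3.1.2, §3.3.1;
Roncal–Stinga 2016 for `(-Δ)^α` on `𝕋ⁿ`); Mathlib has no fractional Laplacian on `UnitAddTorus`.

## References

* L. Grafakos, *Classical Fourier Analysis*, 3rd ed., GTM 249, Springer 2014, Prop. 3.1.2 (9)–(10),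
  Prop. 3.2.4, Prop. 3.2.6 (8). [`Grafakos2014`]
* T. Luo, E. S. Titi, Calc. Var. PDE 59 (2020) = arXiv:1808.07595, §2.1 (the start
  `R₀ = ℛ(∂ₜv₀ + ν(-Δ)^θ v₀) + v₀ ⊗ v₀ + p₀I` of the iteration). [`LuoTiti2020`]
-/

noncomputable section

open MeasureTheory Set Filter Topology UnitAddTorus Function
open scoped ENNReal NNReal InnerProductSpace ContDiff Convolution ComplexConjugate

namespace Literature.Analysis.FluidPDE

namespace Torus

open FunctionSpaces FunctionSpaces.Torus

variable {d : Type*} [Fintype d]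

/-! ## The kernel of `(-Δ)^α (1 - (4π²)⁻¹Δ)^{-M}`, `M = ⌈α⌉ + #d` -/

section Kernel

/-- The order `M = ⌈α⌉ + #d` of the elliptic pre-factor. [folklore] -/
def fracKerOrder (θ : ℝ) (d : Type*) [Fintype d] : ℕ :=
  ⌈θ⌉₊ + Fintype.card d

/-- The multiplier `m_α(k) = (4π²|k|²)^α (1 + |k|²)^{-M}` of the kernel. [folklore] -/
def fracKerSymbol (θ : ℝ) (k : d → ℤ) : ℝ :=
  fracSymbol θ k * ((1 + freqNormSq k) ^ fracKerOrder θ d)⁻¹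

/-- The multiplier is nonnegative. [folklore] -/
theorem fracKerSymbol_nonneg (θ : ℝ) (k : d → ℤ) : 0 ≤ fracKerSymbol θ k :=
  mul_nonneg (fracSymbol_nonneg θ k)
    (inv_nonneg.2 (pow_nonneg (by linarith [freqNormSq_nonneg k]) _))

/-- The multiplier is even. [folklore] -/
theorem fracKerSymbol_neg (θ : ℝ) (k : d → ℤ) : fracKerSymbol θ (-k) = fracKerSymbol θ k := by
  simp [fracKerSymbol, fracSymbol, freqNormSq_neg]

/-- Comparison with the summable weights: `m_α(k) ≤ (4π²)^α (1 + |k|²)^{-#d}` (`α ≥ 0`). [folklore] -/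
theorem fracKerSymbol_le {θ : ℝ} (hθ : 0 ≤ θ) (k : d → ℤ) :
    fracKerSymbol θ k ≤ (4 * Real.pi ^ 2) ^ θ * ((1 + freqNormSq k) ^ Fintype.card d)⁻¹ := by
  have h1 : 0 < 1 + freqNormSq k := by linarith [freqNormSq_nonneg k]
  have hle := fracSymbol_le_mul_pow hθ k
  rw [fracKerSymbol, fracKerOrder, pow_add, mul_inv]
  calc fracSymbol θ k * (((1 + freqNormSq k) ^ ⌈θ⌉₊)⁻¹ * ((1 + freqNormSq k) ^ Fintype.card d)⁻¹)
      = fracSymbol θ k * ((1 + freqNormSq k) ^ ⌈θ⌉₊)⁻¹ * ((1 + freqNormSq k) ^ Fintype.card d)⁻¹ := by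
        ring
    _ ≤ (4 * Real.pi ^ 2) ^ θ * ((1 + freqNormSq k) ^ Fintype.card d)⁻¹ := by
        refine mul_le_mul_of_nonneg_right ?_ (inv_nonneg.2 (pow_nonneg h1.le _))
        rw [← div_eq_mul_inv, div_le_iff₀ (pow_pos h1 _)]
        exact hle

/-- **The multiplier is absolutely summable over `ℤ^d`** (`α ≥ 0`). [folklore] -/
theorem summable_fracKerSymbol {θ : ℝ} (hθ : 0 ≤ θ) : Summable (fracKerSymbol (d := d) θ) :=
  Summable.of_nonneg_of_le (fracKerSymbol_nonneg θ) (fracKerSymbol_le hθ)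
    (summable_inv_one_add_freqNormSq_pow_card.mul_left _)

/-- The kernel as a complex Fourier series: `K_ℂ(x) = ∑ₖ m_α(k) e_k(x)`. [folklore] -/
def fracKernelC (θ : ℝ) (x : UnitAddTorus d) : ℂ :=
  ∑' k : d → ℤ, (fracKerSymbol θ k : ℂ) * mFourier k x

/-- The terms of the kernel series have norm `m_α(k)`. [folklore] -/
theorem norm_fracKerSymbol_mul_mFourier (θ : ℝ) (k : d → ℤ) (x : UnitAddTorus d) :
    ‖(fracKerSymbol θ k : ℂ) * mFourier k x‖ = fracKerSymbol θ k := by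
  rw [norm_mul, norm_mFourier_apply, mul_one, Complex.norm_real, Real.norm_eq_abs,
    abs_of_nonneg (fracKerSymbol_nonneg θ k)]

/-- **The kernel is continuous** (uniformly convergent series of characters, `α ≥ 0`). [folklore] -/
theorem continuous_fracKernelC {θ : ℝ} (hθ : 0 ≤ θ) : Continuous (fracKernelC (d := d) θ) :=
  continuous_tsum (fun k => continuous_const.mul (mFourier k).continuous)
    (summable_fracKerSymbol hθ) fun k x => (norm_fracKerSymbol_mul_mFourier θ k x).le

/-- **The kernel is real**: `conj K_ℂ = K_ℂ` (the multiplier is real and even). [folklore] -/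
theorem conj_fracKernelC (θ : ℝ) (x : UnitAddTorus d) :
    conj (fracKernelC θ x) = fracKernelC θ x := by
  rw [fracKernelC, Complex.conj_tsum]
  simp only [map_mul, Complex.conj_ofReal, ← mFourier_neg]
  rw [show (fun k : d → ℤ => (fracKerSymbol θ k : ℂ) * mFourier (-k) x) =
      (fun k : d → ℤ => (fracKerSymbol θ k : ℂ) * mFourier k x) ∘ (Equiv.neg (d → ℤ)) from
    funext fun k => by simp [fracKerSymbol_neg]]
  exact (Equiv.neg (d → ℤ)).tsum_eq fun k : d → ℤ => (fracKerSymbol θ k : ℂ) * mFourier k x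

/-- **The kernel `K_α`** of `(-Δ)^α(1 - (4π²)⁻¹Δ)^{-M}`, a continuous real function on `T^d`
(the real part of `fracKernelC`, which is already real). [folklore] -/
def fracKernel (θ : ℝ) (x : UnitAddTorus d) : ℝ :=
  (fracKernelC θ x).re

/-- `(K x : ℂ) = K_ℂ x`. [folklore] -/
theorem ofReal_fracKernel (θ : ℝ) (x : UnitAddTorus d) :
    ((fracKernel θ x : ℝ) : ℂ) = fracKernelC θ x :=
  Complex.conj_eq_iff_re.1 (conj_fracKernelC θ x)

/-- The kernel is continuous (`α ≥ 0`). [folklore] -/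
theorem continuous_fracKernel {θ : ℝ} (hθ : 0 ≤ θ) : Continuous (fracKernel (d := d) θ) :=
  Complex.continuous_re.comp (continuous_fracKernelC hθ)

/-- The kernel is integrable (`α ≥ 0`). [folklore] -/
theorem integrable_fracKernel {θ : ℝ} (hθ : 0 ≤ θ) : Integrable (fracKernel (d := d) θ) volume :=
  (continuous_fracKernel hθ).integrable_unitAddTorus

/-- **Fourier coefficients of the kernel**: `𝓕K_ℂ(l) = m_α(l)` (term-wise integration). [folklore] -/
theorem mFourierCoeff_fracKernelC {θ : ℝ} (hθ : 0 ≤ θ) (l : d → ℤ) :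
    mFourierCoeff (fracKernelC (d := d) θ) l = fracKerSymbol θ l := by
  classical
  rw [mFourierCoeff_eq_integral_conj_mul]
  have hterm : ∀ x : UnitAddTorus d, conj (mFourier l x) * fracKernelC θ x =
      ∑' k : d → ℤ, (fracKerSymbol θ k : ℂ) * (conj (mFourier l x) * mFourier k x) := by
    intro x
    rw [fracKernelC, ← tsum_mul_left]
    exact tsum_congr fun k => by ring
  simp_rw [hterm]
  have hmeas : ∀ k : d → ℤ, AEStronglyMeasurable
      (fun x : UnitAddTorus d => (fracKerSymbol θ k : ℂ) * (conj (mFourier l x) * mFourier k x))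
      volume := fun k =>
    (continuous_const.mul ((mFourier l).continuous.star.mul (mFourier k).continuous)).aestronglyMeasurable
  have hnorm : ∀ (k : d → ℤ) (x : UnitAddTorus d),
      ‖(fracKerSymbol θ k : ℂ) * (conj (mFourier l x) * mFourier k x)‖ₑ =
        ENNReal.ofReal (fracKerSymbol θ k) := by
    intro k x
    rw [← ofReal_norm, norm_mul, norm_mul, RCLike.norm_conj, norm_mFourier_apply, norm_mFourier_apply,
      mul_one, mul_one, Complex.norm_real, Real.norm_eq_abs, abs_of_nonneg (fracKerSymbol_nonneg θ k)]
  have hsum : ∑' k : d → ℤ, ∫⁻ x : UnitAddTorus d,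
      ‖(fracKerSymbol θ k : ℂ) * (conj (mFourier l x) * mFourier k x)‖ₑ ≠ ⊤ := by
    simp_rw [hnorm, lintegral_const, measure_univ, mul_one]
    rw [← ENNReal.ofReal_tsum_of_nonneg (fracKerSymbol_nonneg θ) (summable_fracKerSymbol hθ)]
    exact ENNReal.ofReal_ne_top
  rw [integral_tsum hmeas hsum]
  simp_rw [integral_const_mul, integral_conj_mFourier_mul_mFourier]
  rw [tsum_eq_single l fun k hk => by rw [if_neg (Ne.symm hk), mul_zero]]
  rw [if_pos rfl, mul_one]

/-- Fourier coefficients of the real kernel. [folklore] -/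
theorem mFourierCoeff_fracKernel {θ : ℝ} (hθ : 0 ≤ θ) (l : d → ℤ) :
    mFourierCoeff (fun x => ((fracKernel (d := d) θ x : ℝ) : ℂ)) l = fracKerSymbol θ l := by
  rw [show (fun x => ((fracKernel (d := d) θ x : ℝ) : ℂ)) = fracKernelC θ from
    funext (ofReal_fracKernel θ)]
  exact mFourierCoeff_fracKernelC hθ l

end Kernel

/-! ## The fractional Laplacian as a mollification of the elliptic iterate -/

section Representation

variable [DecidableEq d]

/-- The iterated elliptic operator `(1 - (4π²)⁻¹Δ)^m` on vector fields (the operator of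
`Torus.mFourierCoeff_complexify_iterate_oneSubLaplacian`). [folklore] -/
def oneSubLapIter (m : ℕ) (a : UnitAddTorus d → EuclideanSpace ℝ d) :
    UnitAddTorus d → EuclideanSpace ℝ d :=
  (fun b : UnitAddTorus d → EuclideanSpace ℝ d =>
    fun x => b x - (4 * Real.pi ^ 2)⁻¹ • Torus.laplacian b x)^[m] a

omit [DecidableEq d] in
/-- Unfolding `oneSubLapIter`. [folklore] -/
theorem oneSubLapIter_def (m : ℕ) (a : UnitAddTorus d → EuclideanSpace ℝ d) :
    oneSubLapIter m a = (fun b : UnitAddTorus d → EuclideanSpace ℝ d =>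
      fun x => b x - (4 * Real.pi ^ 2)⁻¹ • Torus.laplacian b x)^[m] a := rfl

omit [DecidableEq d] in
/-- Components of Fourier coefficients of a `ℂ^d`-valued function are the Fourier coefficients of
its components. [folklore] -/
theorem mFourierCoeff_apply_coord {W : UnitAddTorus d → EuclideanSpace ℂ d}
    (hW : Integrable W volume) (l : d → ℤ) (i : d) :
    mFourierCoeff W l i = mFourierCoeff (fun x => W x i) l := by
  rw [mFourierCoeff_eq_integral_volume, mFourierCoeff_eq_integral_volume,
    eval_integral_piLp (integrable_mFourier_smul' hW l).eval_piLp i]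
  simp only [PiLp.smul_apply, smul_eq_mul]

omit [DecidableEq d] in
/-- Components of a mollified vector field are the mollified components. [folklore] -/
theorem convolution_apply_coord {K : UnitAddTorus d → ℝ} (hK : Integrable K volume)
    {g : UnitAddTorus d → EuclideanSpace ℝ d} (hg : Continuous g) (x : UnitAddTorus d) (i : d) :
    (K ⋆ g) x i = (K ⋆ fun y => g y i) x := by
  rw [convolution_lsmul, convolution_lsmul,
    eval_integral_piLp (integrable_smul_comp_sub hK hg x).eval_piLp i]
  simp only [PiLp.smul_apply, smul_eq_mul]

/-- The mode series `S(x) = ∑ₖ (4π²|k|²)^α e_k(x) â(k)` (the series inside `fracLaplacian`, before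
the real part) is continuous for smooth `a` (`α ≥ 0`). [folklore] -/
theorem continuous_modeSeries {θ : ℝ} (hθ : 0 ≤ θ) {a : UnitAddTorus d → EuclideanSpace ℝ d}
    (ha : IsSmooth a) :
    Continuous fun x : UnitAddTorus d => ∑' k : d → ℤ,
      fracSymbol θ k • (mFourier k x • mFourierCoeff (EuclideanSpace.complexify ∘ a) k) := by
  refine continuous_tsum (fun k => ?_) (summable_fracSymbol_mul_norm hθ ha)
    (fun k x => norm_fracSymbol_smul_mFourier_smul_le θ k x _)
  exact (continuous_const (y := fracSymbol θ k)).smul ((mFourier k).continuous.smul continuous_const)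

omit [DecidableEq d] in
/-- **Fourier coefficients of a series of modes**: if `∑ₖ σ_k ‖c k‖ < ∞` (`σ = fracSymbol θ`)
then the continuous sum `S(x) = ∑ₖ σ_k e_k(x) c_k` has `𝓕S(l) = σ_l c_l` (term-wise integration
and orthonormality of the characters). [folklore] -/
theorem mFourierCoeff_tsum_modes {θ : ℝ} {c : (d → ℤ) → EuclideanSpace ℂ d}
    (hc : Summable fun k => fracSymbol θ k * ‖c k‖) (l : d → ℤ) :
    mFourierCoeff (fun x : UnitAddTorus d => ∑' k : d → ℤ, fracSymbol θ k • (mFourier k x • c k)) l =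
      ((fracSymbol θ l : ℝ) : ℂ) • c l := by
  classical
  -- the modes as one-term trigonometric polynomials, with complex coefficients `C k = σ_k c_k`
  have hmode : ∀ (k : d → ℤ), (fun x : UnitAddTorus d => fracSymbol θ k • (mFourier k x • c k)) =
      trigPoly {k} (fun m => ((fracSymbol θ m : ℝ) : ℂ) • c m) := by
    intro k
    funext x
    rw [trigPoly_apply, Finset.sum_singleton, fracSymbol_smul_mFourier_smul]
  have hsumx : ∀ x : UnitAddTorus d,
      Summable fun k : d → ℤ => fracSymbol θ k • (mFourier k x • c k) := fun x =>
    Summable.of_norm_bounded hc fun k => norm_fracSymbol_smul_mFourier_smul_le θ k x _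
  have hmeas : ∀ k : d → ℤ, AEStronglyMeasurable
      (fun x : UnitAddTorus d => mFourier (-l) x • (fracSymbol θ k • (mFourier k x • c k))) volume := by
    intro k
    rw [show (fun x : UnitAddTorus d => mFourier (-l) x • (fracSymbol θ k • (mFourier k x • c k))) =
        fun x => mFourier (-l) x • trigPoly {k} (fun m => ((fracSymbol θ m : ℝ) : ℂ) • c m) x from
      funext fun x => by rw [← hmode k]]
    exact ((mFourier (-l)).continuous.smul (continuous_trigPoly _ _)).aestronglyMeasurable
  have hnorm : ∀ (k : d → ℤ) (x : UnitAddTorus d),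
      ‖mFourier (-l) x • (fracSymbol θ k • (mFourier k x • c k))‖ₑ ≤
        ENNReal.ofReal (fracSymbol θ k * ‖c k‖) := by
    intro k x
    rw [← ofReal_norm, norm_smul, norm_mFourier_apply, one_mul]
    exact ENNReal.ofReal_le_ofReal (norm_fracSymbol_smul_mFourier_smul_le θ k x _)
  have hsum : ∑' k : d → ℤ, ∫⁻ x : UnitAddTorus d,
      ‖mFourier (-l) x • (fracSymbol θ k • (mFourier k x • c k))‖ₑ ≠ ⊤ := by
    refine ne_top_of_le_ne_top (b := ∑' k : d → ℤ, ENNReal.ofReal (fracSymbol θ k * ‖c k‖)) ?_ ?_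
    · rw [← ENNReal.ofReal_tsum_of_nonneg (fun k => mul_nonneg (fracSymbol_nonneg θ k) (norm_nonneg _)) hc]
      exact ENNReal.ofReal_ne_top
    · refine ENNReal.tsum_le_tsum fun k => ?_
      calc ∫⁻ x, ‖mFourier (-l) x • (fracSymbol θ k • (mFourier k x • c k))‖ₑ
          ≤ ∫⁻ _ : UnitAddTorus d, ENNReal.ofReal (fracSymbol θ k * ‖c k‖) := lintegral_mono (hnorm k)
        _ = ENNReal.ofReal (fracSymbol θ k * ‖c k‖) := by rw [lintegral_const, measure_univ, mul_one]
  have hswap : ∀ x : UnitAddTorus d,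
      mFourier (-l) x • (∑' k : d → ℤ, fracSymbol θ k • (mFourier k x • c k)) =
        ∑' k : d → ℤ, mFourier (-l) x • (fracSymbol θ k • (mFourier k x • c k)) := fun x =>
    ((hsumx x).tsum_const_smul (mFourier (-l) x)).symm
  have hk : ∀ k : d → ℤ, ∫ x, mFourier (-l) x • (fracSymbol θ k • (mFourier k x • c k)) =
      if l = k then ((fracSymbol θ l : ℝ) : ℂ) • c l else 0 := by
    intro k
    have h := mFourierCoeff_trigPoly {k} (fun m => ((fracSymbol θ m : ℝ) : ℂ) • c m) l
    rw [mFourierCoeff_eq_integral_volume, ← hmode k] at h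
    rw [h]
    simp only [Finset.mem_singleton]
  rw [mFourierCoeff_eq_integral_volume]
  simp_rw [hswap]
  rw [integral_tsum hmeas hsum]
  simp_rw [hk]
  rw [tsum_eq_single l fun k hk' => by rw [if_neg (Ne.symm hk')]]
  rw [if_pos rfl]

/-- **`(-Δ)^α` as a mollification**: for smooth `a` and `α ≥ 0`,
`(-Δ)^α a = K_α ⋆ ((1 - (4π²)⁻¹Δ)^M a)` with `M = ⌈α⌉ + #d` and the continuous real kernel
`K_α = Torus.fracKernel α` — both sides are continuous with Fourier coefficients
`(4π²|k|²)^α â(k)` (`m_α(k)(1 + |k|²)^M = (4π²|k|²)^α`; convolution theorem, Grafakos 2014,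
Prop. 3.1.2 (9)), hence equal (Prop. 3.2.4). [cite: Grafakos2014, Prop. 3.1.2 (9)] -/
theorem fracLaplacian_eq_convolution {θ : ℝ} (hθ : 0 ≤ θ) {a : UnitAddTorus d → EuclideanSpace ℝ d}
    (ha : IsSmooth a) :
    fracLaplacian θ a = fracKernel θ ⋆ oneSubLapIter (fracKerOrder θ d) a := by
  classical
  set M := fracKerOrder θ d with hM_def
  set g : UnitAddTorus d → EuclideanSpace ℝ d := oneSubLapIter M a with hg_def
  have hg : IsSmooth g := isSmooth_iterate_oneSubLaplacian ha M
  set u : UnitAddTorus d → EuclideanSpace ℝ d := fracKernel θ ⋆ g with hu_def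
  have hu : IsSmooth u := isSmooth_convolution (integrable_fracKernel hθ) hg
  -- the mode series and the coefficients of the complexified left side
  set c : (d → ℤ) → EuclideanSpace ℂ d := fun k => mFourierCoeff (EuclideanSpace.complexify ∘ a) k
    with hc_def
  set S : UnitAddTorus d → EuclideanSpace ℂ d := fun x => ∑' k : d → ℤ,
    fracSymbol θ k • (mFourier k x • c k) with hS_def
  have hSc : Continuous S := continuous_modeSeries hθ ha
  have hfracS : fracLaplacian θ a = fun x => EuclideanSpace.realPart (S x) :=
    funext fun x => fracLaplacian_def θ a x
  have hcsymm : IsConjSymm fun l => ((fracSymbol θ l : ℝ) : ℂ) • c l := by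
    intro l
    have h1 := isConjSymm_mFourierCoeff ha.integrable l
    simp only [hc_def]
    rw [EuclideanSpace.conjVec_smul, Complex.conj_ofReal, ← h1, fracSymbol, fracSymbol, freqNormSq_neg]
  have hcoefL : ∀ l, mFourierCoeff (EuclideanSpace.complexify ∘ fracLaplacian θ a) l =
      ((fracSymbol θ l : ℝ) : ℂ) • c l := by
    intro l
    rw [hfracS]
    exact mFourierCoeff_complexify_realPart_comp_of_isConjSymm hSc.integrable_unitAddTorus hcsymm
      (fun k => mFourierCoeff_tsum_modes (summable_fracSymbol_mul_norm hθ ha) k) l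
  -- coefficients of the complexified right side, componentwise
  have hcoefR : ∀ (l : d → ℤ) (i : d), mFourierCoeff (fun x => ((u x i : ℝ) : ℂ)) l =
      ((fracSymbol θ l : ℝ) : ℂ) * c l i := by
    intro l i
    have hgi : Continuous fun y => g y i := (continuous_apply i).comp (PiLp.continuous_ofLp 2 _|>.comp hg.continuous)
    have h1 : (fun x => ((u x i : ℝ) : ℂ)) = fracKernel θ ⋆ fun y => ((g y i : ℝ) : ℂ) := by
      funext x
      rw [hu_def, convolution_apply_coord (integrable_fracKernel hθ) hg.continuous x i, ofReal_convolution]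
    have h2 : mFourierCoeff (fun y => ((g y i : ℝ) : ℂ)) l =
        (((1 + freqNormSq l) ^ M : ℝ) : ℂ) * c l i := by
      have h3 := mFourierCoeff_complexify_iterate_oneSubLaplacian ha M l
      rw [← oneSubLapIter_def, ← hg_def] at h3
      have h4 : mFourierCoeff (fun y => ((g y i : ℝ) : ℂ)) l =
          mFourierCoeff (EuclideanSpace.complexify ∘ g) l i := by
        rw [mFourierCoeff_apply_coord (integrable_complexify_comp hg.integrable) l i]
        rfl
      rw [h4, h3, PiLp.smul_apply, smul_eq_mul]
    rw [h1, mFourierCoeff_convolution (w := fun y => ((g y i : ℝ) : ℂ)) (continuous_fracKernel hθ)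
      (Complex.continuous_ofReal.comp hgi), mFourierCoeff_fracKernel hθ, h2, ← mul_assoc]
    congr 1
    have hpos : (0 : ℝ) < (1 + freqNormSq l) ^ M := pow_pos (by linarith [freqNormSq_nonneg l]) M
    rw [fracKerSymbol, ← hM_def]
    push_cast
    have hne : ((1 : ℂ) + (freqNormSq l : ℂ)) ^ M ≠ 0 := by exact_mod_cast hpos.ne'
    rw [mul_assoc, inv_mul_cancel₀ hne, mul_one]
  -- compare componentwise
  funext x
  have hcomp : ∀ i, (fun y => ((fracLaplacian θ a y i : ℝ) : ℂ)) = fun y => ((u y i : ℝ) : ℂ) := by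
    intro i
    refine eq_of_forall_mFourierCoeff_eq ?_ ?_ fun l => ?_
    · exact Complex.continuous_ofReal.comp ((continuous_apply i).comp
        (PiLp.continuous_ofLp 2 _|>.comp (continuous_fracLaplacian hθ ha)))
    · exact Complex.continuous_ofReal.comp ((continuous_apply i).comp
        (PiLp.continuous_ofLp 2 _|>.comp hu.continuous))
    · have h1 : mFourierCoeff (fun y => ((fracLaplacian θ a y i : ℝ) : ℂ)) l =
          mFourierCoeff (EuclideanSpace.complexify ∘ fracLaplacian θ a) l i := by
        rw [mFourierCoeff_apply_coord (integrable_complexify_comp (integrable_fracLaplacian hθ ha)) l i]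
        rfl
      rw [h1, hcoefL, hcoefR, PiLp.smul_apply, smul_eq_mul]
  ext i
  have h := congr_fun (hcomp i) x
  exact_mod_cast h

/-- **`(-Δ)^α a` is smooth for smooth `a`** (`α ≥ 0`): a mollification of the smooth elliptic
iterate by an integrable kernel. [folklore] -/
theorem _root_.Literature.Analysis.FunctionSpaces.Torus.IsSmooth.fracLaplacian {θ : ℝ} (hθ : 0 ≤ θ)
    {a : UnitAddTorus d → EuclideanSpace ℝ d} (ha : IsSmooth a) : IsSmooth (fracLaplacian θ a) := by
  rw [fracLaplacian_eq_convolution hθ ha]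
  exact isSmooth_convolution (integrable_fracKernel hθ) (isSmooth_iterate_oneSubLaplacian ha _)

/-- **Joint space–time smoothness of `(-Δ)^α`**: for `u` smooth on `ℝ × T^d` and `α ≥ 0`, the
field `t ↦ (-Δ)^α (u t)` is smooth on `ℝ × T^d` (slice-wise: `K_α ⋆ (1 - (4π²)⁻¹Δ)^M u(t)`, and
mollification in space of a jointly smooth field is jointly smooth,
`Torus.IsSmoothSpaceTimeOn.convolution`). [folklore] -/
theorem _root_.Literature.Analysis.FunctionSpaces.Torus.IsSmoothSpaceTimeOn.fracLaplacian_univ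
    {θ : ℝ} (hθ : 0 ≤ θ) {u : ℝ → UnitAddTorus d → EuclideanSpace ℝ d}
    (hu : IsSmoothSpaceTimeOn univ u) :
    IsSmoothSpaceTimeOn univ (fun t => fracLaplacian θ (u t)) := by
  set M := fracKerOrder θ d with hM_def
  have h1 : IsSmoothSpaceTimeOn univ (fun t => fracKernel θ ⋆
      ((fun c : ℝ → UnitAddTorus d → EuclideanSpace ℝ d =>
        fun s x => c s x - (4 * Real.pi ^ 2)⁻¹ • Torus.laplacian (c s) x)^[M] u) t) :=
    (isSmoothSpaceTimeOn_iterate hu M).convolution (integrable_fracKernel hθ) convex_univ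
      (by rw [interior_univ]; exact univ_nonempty)
  have h2 : (fun t => fracLaplacian θ (u t)) = fun t => fracKernel θ ⋆
      ((fun c : ℝ → UnitAddTorus d → EuclideanSpace ℝ d =>
        fun s x => c s x - (4 * Real.pi ^ 2)⁻¹ • Torus.laplacian (c s) x)^[M] u) t := by
    funext t
    rw [iterate_spaceTime_slice, fracLaplacian_eq_convolution hθ (hu.isSmooth_slice (mem_univ t))]
    rfl
  rw [h2]
  exact h1

end Representation

end Torus

end Literature.Analysis.FluidPDE
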